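import Summits.CriticalPhenomena.PercolationContinuityZ3.Theorems.PercNearOneGluingNoHeavyLowerTailKNGoodHairTools
import HarnessLib

/-!
# Lowering pairs at the LOSER preserves the connection order — the port-free witness reduction for Conjecture M
# (`NoHeavyLowerTail` cell, stmt-CriticalPhenomena-4575; prover `prim-hp-2`, deletion–contraction line, gen 4)

Support file (`--supports stmt-CriticalPhenomena-4575`).  No definitions, no named facts, no sorries.
`μ_w = prodBernoulli w` on `Fin n`; `w[e ↦ u] = Function.update w e u`.

* `KNGoodLoser.real_openConn_update_one_glued` — under `w[s(a,z) ↦ 1]` the two end points are exchangeable for `· ↔ b`: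
  `μ_{w[s(a,z)↦1]}(z ↔ b) = μ_{w[s(a,z)↦1]}(a ↔ b)`.
* `KNGoodLoser.openConn_le_of_lower_pair` — **loser-lowering, one pair**: if `μ_w(a ↔ b) ≤ μ_w(c ↔ b)` (the relay `a` LOSES against `c`
  in `w`) and `w s(a,z) < 1`, then for every `t ≤ w s(a,z)`, `μ_{w[s(a,z)↦t]}(a ↔ b) ≤ μ_{w[s(a,z)↦t]}(c ↔ b)`: lowering a pair AT THE LOSER
  keeps it the loser.  Proof: `u ↦ μ_{w[e↦u]}(c ↔ b) − μ_{w[e↦u]}(a ↔ b)` is affine (`stub_oneBondDecomp_k15`); if it were negative at `t`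
  then `a` would win strictly at `t`, hence (in-graph gluing transfer `KNGoodHair.glueTransfer_openConn`, gluing `z` into the winner `a`)
  win weakly at `u = 1`, and by affinity win strictly at every `u ∈ [t, 1)`, in particular at `u = w s(a,z)` — contradiction.
  (The hypothesis `w s(a,z) < 1` is necessary: un-gluing a tie can reverse it.)
* `KNGoodLoser.openConn_le_of_lower_pairs` — the same for any finite set of pairs at `a` (induction).
* `KNGoodLoser.argmin_of_lower_pairs` — an `argmin_A μ_w(· ↔ b)` stays an argmin after lowering pairs at itself.
* `KNGoodLoser.openConn_le_of_raise_pair` — the dual: raising a pair at a WINNER to any weight keeps it a winner (gen 4 addendum).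
Use (port-free witness reduction, this cell): in Conjecture M / the gluing inequality GC the witness `a = argmin_Γ` may be assumed NOT adjacent
to the observer, since `agood(Γ₂, v; a) = (1 − w₂ s(v,a))·agood(Γ₂ − va, v; a)` (`KNGoodSeries.agood_affine_pair`, corner value `0` at `u = 1`)
and `a ∈ argmin_{Γ − va}` by `argmin_of_lower_pairs`.
-/

noncomputable section

namespace Summit.CriticalPhenomena.PercolationContinuityZ3.Theorems

open MeasureTheory Set Literature.Probability.LatticeModels Literature.Probability.Percolation
open scoped Classical BigOperators

variable {n : ℕ}

namespace KNGoodLoser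

open ChampionStability KNGoodHair

/-- Under `w[s(a,z) ↦ 1]` (the pair `a z` glued), `μ(z ↔ b) = μ(a ↔ b)`. [folklore] -/
theorem real_openConn_update_one_glued (w : Sym2 (Fin n) → unitInterval) (a z b : Fin n) (haz : a ≠ z) :
    (prodBernoulli (Function.update w s(a, z) 1)).real (openConn z b) =
      (prodBernoulli (Function.update w s(a, z) 1)).real (openConn a b) := by
  rw [tieLiftTwo_real_update_one w s(a, z), tieLiftTwo_real_update_one w s(a, z)]
  congr 1
  ext ω
  simp only [mem_preimage]
  show (openGraph (insert s(a, z) ω)).Reachable z b ↔ (openGraph (insert s(a, z) ω)).Reachable a b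
  have h1 : (openGraph (insert s(a, z) ω)).Reachable a b ↔
      ((openGraph ω).Reachable a b ∨ (openGraph ω).Reachable z b) := reachable_insert_left_iff ω haz b
  have h2 : (openGraph (insert s(z, a) ω)).Reachable z b ↔
      ((openGraph ω).Reachable z b ∨ (openGraph ω).Reachable a b) := reachable_insert_left_iff ω (Ne.symm haz) b
  rw [Sym2.eq_swap] at h2
  rw [h1, h2, or_comm]

/-- **Loser-lowering, one pair.**  If `μ_w(a ↔ b) ≤ μ_w(c ↔ b)` and `w s(a,z) < 1`, then lowering the pair `s(a,z)` to any
`t ≤ w s(a,z)` keeps `μ(a ↔ b) ≤ μ(c ↔ b)`. [folklore; via KozmaNitzan2024 Lemma 5 / vdBHK Thm 1.5 (`glueTransfer_openConn`)] -/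
theorem openConn_le_of_lower_pair (w : Sym2 (Fin n) → unitInterval) (a z c b : Fin n) (haz : a ≠ z)
    (t : unitInterval) (ht : t ≤ w s(a, z)) (hlt : (w s(a, z) : ℝ) < 1)
    (hle : (prodBernoulli w).real (openConn a b) ≤ (prodBernoulli w).real (openConn c b)) :
    (prodBernoulli (Function.update w s(a, z) t)).real (openConn a b) ≤
      (prodBernoulli (Function.update w s(a, z) t)).real (openConn c b) := by
  set e : Sym2 (Fin n) := s(a, z) with he
  set μ0 := prodBernoulli (Function.update w e 0) with hμ0
  set μ1 := prodBernoulli (Function.update w e 1) with hμ1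
  have hdec : ∀ (u : unitInterval) (S : Set (BondConfig (Fin n))),
      (prodBernoulli (Function.update w e u)).real S = (1 - (u : ℝ)) * μ0.real S + (u : ℝ) * μ1.real S := by
    intro u S
    have h := stub_oneBondDecomp_k15 n (Function.update w e u) e S
    rwa [Function.update_idem, Function.update_idem, Function.update_self] at h
  -- the hypothesis, read at `u = w e`
  have hwe : Function.update w e (w e) = w := Function.update_eq_self e w
  have hA : (1 - (w e : ℝ)) * μ0.real (openConn a b) + (w e : ℝ) * μ1.real (openConn a b) ≤
      (1 - (w e : ℝ)) * μ0.real (openConn c b) + (w e : ℝ) * μ1.real (openConn c b) := by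
    rw [← hdec, ← hdec, hwe]; exact hle
  by_contra hcon
  push Not at hcon
  -- at `t`, `a` wins strictly; glue `z` into the winner `a`
  have hglue := glueTransfer_openConn (Function.update w e t) z a c b (Ne.symm haz) (le_of_lt hcon)
  rw [Sym2.eq_swap, ← he, Function.update_idem] at hglue
  rw [← hμ1] at hglue
  have hza : μ1.real (openConn z b) = μ1.real (openConn a b) := by
    rw [hμ1, he]; exact real_openConn_update_one_glued w a z b haz
  rw [hza] at hglue
  -- hglue : μ1(c ↔ b) ≤ μ1(a ↔ b);  hcon at t;  hA at w e;  t ≤ w e < 1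
  rw [hdec t, hdec t] at hcon
  have ht' : (t : ℝ) ≤ (w e : ℝ) := by exact_mod_cast ht
  have ht0 : 0 ≤ (t : ℝ) := t.2.1
  nlinarith [hA, hcon, hglue, ht', hlt, ht0, mul_nonneg (sub_nonneg.2 ht') (sub_nonneg.2 hglue)]

/-- **Loser-lowering, several pairs.**  If `μ_w(a ↔ b) ≤ μ_w(c ↔ b)` and `w'` differs from `w` only on pairs `s(a,z)`, `z ∈ Z`,
with `w' s(a,z) ≤ w s(a,z) < 1` there, then `μ_{w'}(a ↔ b) ≤ μ_{w'}(c ↔ b)`. [folklore] -/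
theorem openConn_le_of_lower_pairs (a c b : Fin n) (Z : Finset (Fin n)) :
    ∀ (w w' : Sym2 (Fin n) → unitInterval), a ∉ Z →
      (∀ e, (∀ z ∈ Z, e ≠ s(a, z)) → w' e = w e) →
      (∀ z ∈ Z, w' s(a, z) ≤ w s(a, z)) → (∀ z ∈ Z, (w s(a, z) : ℝ) < 1) →
      (prodBernoulli w).real (openConn a b) ≤ (prodBernoulli w).real (openConn c b) →
      (prodBernoulli w').real (openConn a b) ≤ (prodBernoulli w').real (openConn c b) := by
  induction Z using Finset.induction_on with
  | empty =>
    intro w w' _ hoff _ _ hle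
    have : w' = w := funext fun e => hoff e (by simp)
    rw [this]; exact hle
  | @insert z₀ Z hz₀ ih =>
    intro w w' haZ hoff hlow hlt hle
    have haz₀ : a ≠ z₀ := by
      rintro rfl; exact haZ (Finset.mem_insert_self _ _)
    have haZ' : a ∉ Z := fun h => haZ (Finset.mem_insert_of_mem h)
    -- first lower the pair `s(a, z₀)` in `w`, then the rest by induction
    set w₁ := Function.update w s(a, z₀) (w' s(a, z₀)) with hw₁
    have h1 : (prodBernoulli w₁).real (openConn a b) ≤ (prodBernoulli w₁).real (openConn c b) :=
      openConn_le_of_lower_pair w a z₀ c b haz₀ (w' s(a, z₀)) (hlow z₀ (Finset.mem_insert_self _ _))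
        (hlt z₀ (Finset.mem_insert_self _ _)) hle
    have hne : ∀ z ∈ Z, s(a, z) ≠ s(a, z₀) := by
      intro z hz h
      have : z = z₀ := by
        have h' := Sym2.congr_right (a := a) |>.1 h
        exact h'
      exact hz₀ (this ▸ hz)
    refine ih w₁ w' haZ' ?_ ?_ ?_ h1
    · intro e he'
      by_cases hez : e = s(a, z₀)
      · rw [hez, hw₁, Function.update_self]
      · rw [hw₁, Function.update_of_ne hez]
        exact hoff e fun z hz => by
          rcases Finset.mem_insert.1 hz with rfl | hz
          · exact hez
          · exact he' z hz
    · intro z hz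
      rw [hw₁, Function.update_of_ne (hne z hz)]
      exact hlow z (Finset.mem_insert_of_mem hz)
    · intro z hz
      rw [hw₁, Function.update_of_ne (hne z hz)]
      exact hlt z (Finset.mem_insert_of_mem hz)

/-- **An argmin stays an argmin after lowering pairs at itself.**  If `a ∈ A` minimises `μ_w(· ↔ b)` over `A` and `w'` is `w` with
the pairs `s(a,z)`, `z ∈ Z` (all of `w`-weight `< 1`), lowered, then `a` minimises `μ_{w'}(· ↔ b)` over `A`. [folklore] -/
theorem argmin_of_lower_pairs (w w' : Sym2 (Fin n) → unitInterval) (A : Finset (Fin n)) (a b : Fin n) (Z : Finset (Fin n))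
    (haZ : a ∉ Z) (hoff : ∀ e, (∀ z ∈ Z, e ≠ s(a, z)) → w' e = w e)
    (hlow : ∀ z ∈ Z, w' s(a, z) ≤ w s(a, z)) (hlt : ∀ z ∈ Z, (w s(a, z) : ℝ) < 1)
    (hmin : ∀ c ∈ A, (prodBernoulli w).real (openConn a b) ≤ (prodBernoulli w).real (openConn c b)) :
    ∀ c ∈ A, (prodBernoulli w').real (openConn a b) ≤ (prodBernoulli w').real (openConn c b) :=
  fun c hc => openConn_le_of_lower_pairs a c b Z w w' haZ hoff hlow hlt (hmin c hc)

/-- **Winner-raising, one pair** (the dual of `openConn_le_of_lower_pair`; Kozma–Nitzan's Lemma 3(i) with `Q = {pair open}`, for an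
arbitrary target weight): if `μ_w(c ↔ b) ≤ μ_w(a ↔ b)` (the vertex `a` WINS against `c` in `w`) and `w s(a,z) < 1`, then raising the pair
`s(a,z)` to any `t ≥ w s(a,z)` keeps `μ(c ↔ b) ≤ μ(a ↔ b)`.  Proof: the difference is affine in the weight, `≥ 0` at `w s(a,z)` (hypothesis)
and at `1` (`KNGoodHair.glueTransfer_openConn`), hence on the whole interval between. [folklore; cite: KozmaNitzan2024, Lemma 3(i) (p. 6)] -/
theorem openConn_le_of_raise_pair (w : Sym2 (Fin n) → unitInterval) (a z c b : Fin n) (haz : a ≠ z)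
    (t : unitInterval) (ht : w s(a, z) ≤ t) (hlt : (w s(a, z) : ℝ) < 1)
    (hle : (prodBernoulli w).real (openConn c b) ≤ (prodBernoulli w).real (openConn a b)) :
    (prodBernoulli (Function.update w s(a, z) t)).real (openConn c b) ≤
      (prodBernoulli (Function.update w s(a, z) t)).real (openConn a b) := by
  set e : Sym2 (Fin n) := s(a, z) with he
  set μ0 := prodBernoulli (Function.update w e 0) with hμ0
  set μ1 := prodBernoulli (Function.update w e 1) with hμ1
  have hdec : ∀ (u : unitInterval) (S : Set (BondConfig (Fin n))),
      (prodBernoulli (Function.update w e u)).real S = (1 - (u : ℝ)) * μ0.real S + (u : ℝ) * μ1.real S := by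
    intro u S
    have h := stub_oneBondDecomp_k15 n (Function.update w e u) e S
    rwa [Function.update_idem, Function.update_idem, Function.update_self] at h
  have hwe : Function.update w e (w e) = w := Function.update_eq_self e w
  have hA : (1 - (w e : ℝ)) * μ0.real (openConn c b) + (w e : ℝ) * μ1.real (openConn c b) ≤
      (1 - (w e : ℝ)) * μ0.real (openConn a b) + (w e : ℝ) * μ1.real (openConn a b) := by
    rw [← hdec, ← hdec, hwe]; exact hle
  -- at weight `1`: gluing transfer (glue `z` into the winner `a`)
  have hglue := glueTransfer_openConn w z a c b (Ne.symm haz) hle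
  rw [Sym2.eq_swap, ← he] at hglue
  rw [← hμ1] at hglue
  have hza : μ1.real (openConn z b) = μ1.real (openConn a b) := by
    rw [hμ1, he]; exact real_openConn_update_one_glued w a z b haz
  rw [hza] at hglue
  rw [hdec t, hdec t]
  have ht' : (w e : ℝ) ≤ (t : ℝ) := by exact_mod_cast ht
  have ht1 : (t : ℝ) ≤ 1 := t.2.2
  nlinarith [hA, hglue, ht', hlt, ht1, mul_nonneg (sub_nonneg.2 ht') (sub_nonneg.2 hglue),
    mul_nonneg (sub_nonneg.2 ht1) (sub_nonneg.2 hglue)]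

end KNGoodLoser

end Summit.CriticalPhenomena.PercolationContinuityZ3.Theorems

end
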